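import Summits.RiemannHypothesis.RiemannHypothesis.Theorems.WeilTwoPrimeDeflM80PBase
import Summits.RiemannHypothesis.RiemannHypothesis.Theorems.WeilTwoPrimeDeflM80PDataR
import Summits.RiemannHypothesis.RiemannHypothesis.Theorems.WeilTwoPrimeDeflM80FDataNu
import Literature.NumberTheory.LFunctions.WeilTwoPrimeCellsT120
import Literature.NumberTheory.LFunctions.WeilTwoPrimeCertificateDeflated
import HarnessLib

/-!
# Even-sector deflated two-prime certificate M80P: the certificate `weilCertDeflM80P : WeilCert23` and its augmented coefficient matrix

`weilCertDeflM80P` = base `weilCertDeflM80PBase` + `j = 5` + `pnu = 64` + the cells `weilTwoPrimeCellsT120` + support `b = 4023/5000` + the moment table `weilCertDeflM80FNu` of certificate M80F (same `a₀`, `N`: identical table, reused by name); penalty data `weilCertDeflM80PR`; `weilCertDeflM80PP = P_r + Σ μ ĉ ĉᵀ`. [cite: Yoshida1992, §6, Thm 1 p. 310] Data only.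
-/

set_option linter.dupNamespace false

noncomputable section

namespace Summit.RiemannHypothesis.RiemannHypothesis.Theorems.EvenWinsBeyondArch

open Literature.NumberTheory.LFunctions

/-- **The even-sector deflated two-prime certificate M80P** (`a₀ = b = 4023/5000`, `N = 271`, `T = 120`, `β₂₃ = 17/25`, k_even = 6). [folklore] -/
def weilCertDeflM80P : WeilCert23 := ⟨weilCertDeflM80PBase, 5, 64, weilTwoPrimeCellsT120, 4023/5000, weilCertDeflM80FNu⟩

/-- The base of `weilCertDeflM80P` is `weilCertDeflM80PBase` (definitional). [folklore] -/
theorem weilCertDeflM80P_base : weilCertDeflM80P.base = weilCertDeflM80PBase := rfl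

/-- The table of `weilCertDeflM80P` is `weilCertDeflM80FNu` (definitional). [folklore] -/
theorem weilCertDeflM80P_nuTab : weilCertDeflM80P.nuTab = weilCertDeflM80FNu := rfl

/-- The augmented coefficient matrix `P_r + Σ μ ĉ ĉᵀ` of certificate M80P. [folklore] -/
def weilCertDeflM80PP (k l : ℕ) : ℚ := weilCertDeflM80PBase.prQ weilCertDeflM80FNu k l + rankOneQ weilCertDeflM80PR k l

/-- `weilCertDeflM80PP` is the augmented matrix of the certificate (definitional). [folklore] -/
theorem weilCertDeflM80PP_eq : weilCertDeflM80PP = fun k l ↦ weilCertDeflM80P.base.prQ weilCertDeflM80P.nuTab k l + rankOneQ weilCertDeflM80PR k l := rfl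

end Summit.RiemannHypothesis.RiemannHypothesis.Theorems.EvenWinsBeyondArch
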